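import Mathlib
import HarnessLib
import Literature.MathematicalPhysics.QuantumLattice.GrassmannChargeScaling
import Literature.Probability.LatticeModels.TorusCentredLift
import Summits.HubbardSuperconductivity.HubbardSuperconductivity.Theorems.KLProgrammeKLRegimeEngineSectorisedKernelTransfer
import Summits.HubbardSuperconductivity.HubbardSuperconductivity.Theorems.KLProgrammeKLRegimeEngineV8E5TrivialOverlap

/-!
# Route `KLProgramme` — crux K3 ENGINE (stmt-HubbardSuperconductivity-20437 `KLRegimeEngineV17F2`), stub (e) proof-input «(e)-D-ROWS», keying (A′) (pen (R495)):
# THE PINNED RAW TWO-LEG ROWS OF AN EXTERNAL-LEG DRESSING `S_c G − G` (the `S_m` of k3c4-p2's frame-mismatch resummation), through k3c2-p2's transfer identity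
# (cell gate-hubbard-kl, seat hubbard-kl-k3c4-p1 g26, VL lane; memo DROWS-SCOPE-g26.md §14; consumer: the `Pe` rows of `…TwoVolumeDualRowsFrameSplit.hPd_of_commonFrame_add_conversion`)

Under (A′) the fine volume's one-shot action at its own frame is the frame-`K₁` action up to the mismatch chain and ONE external-leg dressing
`S_m = ExteriorAlgebra.map (mulLeft m)`, `m(X) = (1 + Ψ_{K₂}(X.1)·κ_D(X.1))⁻¹` a function of the MOMENTUM label only (`…TwoVolumeFrameMismatchResum`, p549694;
exact below temperature, `…TwoVolumeLastScaleFrameExact`).  The spatial dual row reads ε-weighted PINNED rows of RAW (trivially sectorised) two-leg kernels.  This file bounds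
the pinned raw two-leg rows of `S_c G − G` for ANY `G` and ANY momentum weight `c X = v(X.1.1)`, generically, by PRODUCT constants — the `ε`-normalised pin row of the
overlap kernel of `v − 1`, the `ε`-normalised column sums of the overlap kernels of `v` and of `v − 1` — times the sup of the pinned raw rows of `G`:

* §1 `sectorisedKernel_map_mulLeft_momentum` — `W[F](S_c G) = W[F·v](G)`: a momentum weight on the fields is a multiplier on every leg (`kernel_map_mulLeft`);
* §2 `sectorisedKernel_mulLeft_sub_two` — two legs: `m₀m₁ − 1 = (m₀ − 1)·m₁ + 1·(m₁ − 1)`, i.e. the raw two-leg kernel of `S_c G − G` is the sum of two kernels of `G`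
  sectorised by the three-member family `(1, v − 1, v)` (`![1, v − 1, v]`);
* §3 `sum_prod_norm_vecCons_le'`, **`fixedTupleL1_le_of_plateau_transfer'`** — k3c2-p2's `…EngineSectorisedKernelTransfer.fixedTupleL1_le_of_plateau_transfer` (p-landed)
  with LEG-DEPENDENT column constants and a separate pin-row constant (`#Par · (Cr · ∏_j Cc_j) · S` instead of `#Par · C_τ^{m+1} · S`; proof = theirs, verbatim
  otherwise) — the refinement that keeps the smallness of ONE leg's multiplier;
* §4 **`fixedTupleL1_dress_sub_le`** — `fixedTupleL1 β 1 (W[1](S_c G − G)) Ω x₀ ≤ (Rδ·Cv + Cδ)·S` from the pin row `Rδ` of `Θ_{v−1}` at `x₀`, the column sums `Cv`, `Cδ`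
  of `Θ_v`, `Θ_{v−1}` (all `ε`-normalised, `Θ_w = E(w)·S(1)` the overlap kernel) and `S ≥` every pinned raw row of `G` (the trivial member's rows are EXACTLY `ε⁻¹`,
  `KLRegimeSplit.rowSum_overlap_trivial_label_eq`); `fixedTupleL1_one_eq_sum` (the `m = 1` fixed-tuple size is the `ε`-weighted pinned row `ε·Σ_{x₁}‖W Ω ![x₀,x₁]‖`);
* §5 `proj_cRep_injective_of_le`, `sum_sum_lift_le_sum`, **`sum_lifted_offsets_le_two_mul`** — the two lifted offset rows of `hdualSp` at a fine pin (`of.2 ± proj(cRep ȳ)`)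
  are at most twice the full pinned row (the lift between nested tori is injective).

Pure bookkeeping + k3c2-p2's convolution identity; the `ℓ¹` data of `v`, `v − 1` are hypotheses (their Fourier estimates for `v = m` are the «VL-RESUM-WINDOW» file);
nothing asserts the (D) rows, (e), VL, K3 or superconductivity.  References: BGM 2006 §2.3 (2.21)–(2.24), §2.7 (2.70)–(2.71a) [cite: BenfattoGiulianiMastropietro2006];
Feldman–Salmhofer–Trubowitz 1996 §1 (external-leg dressing by the counterterm).
-/

noncomputable section

namespace Summit.HubbardSuperconductivity.HubbardSuperconductivity.Theorems.TwoVolumeDefect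

set_option linter.dupNamespace false -- summit = problem name (single-conjunct summit), D-0017

open Finset Complex Literature.MathematicalPhysics.QuantumLattice Literature.Probability.LatticeModels GrassmannAlgebra
open Summit.HubbardSuperconductivity.HubbardSuperconductivity.Theorems.KLRegimeSplit
open Summit.HubbardSuperconductivity.HubbardSuperconductivity.Theorems.KLProgrammeLegKernels
open Summit.HubbardSuperconductivity.HubbardSuperconductivity.Theorems.EngineV8

variable {L M : ℕ}

/-! ## §1 A momentum weight on the fields is a multiplier on every leg -/

section Weight

variable [NeZero L]

/-- **`W[F](S_c G) = W[F·v](G)`**: for a weight `c` depending on the momentum label only (`c X = v X.1.1`), the `F`-sectorised kernels of the rescaled element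
`S_c G = map (mulLeft c) G` are the `(F·v)`-sectorised kernels of `G` (`kernel_map_mulLeft`). [cite: BenfattoGiulianiMastropietro2006, §2.7 (2.70)] -/
theorem sectorisedKernel_map_mulLeft_momentum {N : ℕ} (β : ℝ) (F : Fin N → FreqMomentum L M → ℂ) (c : HubbardFieldIdx L M → ℂ) (v : FreqMomentum L M → ℂ)
    (hc : ∀ X, c X = v X.1.1) (G : HubbardGrassmann L M) (m : ℕ) (Ω : Fin m → SectorLeg N) (x : Fin m → SpaceTimeIdx L M) :
    sectorisedKernel L M β F (ExteriorAlgebra.map (LinearMap.mulLeft ℂ c) G) m Ω x = sectorisedKernel L M β (fun s k => F s k * v k) G m Ω x := by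
  rw [sectorisedKernel_def, sectorisedKernel_def]
  refine sum_congr rfl fun k _ => ?_
  rw [kernel_map_mulLeft, ← mul_assoc]
  congr 1
  rw [← prod_mul_distrib]
  refine prod_congr rfl fun i _ => ?_
  rw [hc]
  ring

end Weight

/-! ## §2 Two legs: the dressing difference as two sectorised kernels of the three-member family `(1, v − 1, v)` -/

section TwoLegs

variable [NeZero L]

/-- The member-`0` overlap entries of the dressing family `(1, v − 1, v)` ARE the trivial overlap entries (`E(F′)·S(1)` reads `F′` only at the row's sector). -/
theorem dress_overlap_zero_eq (β : ℝ) (v : FreqMomentum L M → ℂ) (x y : SpaceTimeIdx L M) (σ c : Fin 2) (ℓ : SectorLeg 1) :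
    (sectorAnalysisMatrix L M β (![fun _ => 1, fun k => v k - 1, v] : Fin 3 → FreqMomentum L M → ℂ) * sectorSubMatrix L M β (trivialMultiplier L M)) (x, (((0 : Fin 3), σ), c)) (y, ℓ) =
      (sectorAnalysisMatrix L M β (trivialMultiplier L M) * sectorSubMatrix L M β (trivialMultiplier L M)) (x, (((0 : Fin 1), σ), c)) (y, ℓ) := by
  rw [sectorAnalysis_mul_sectorSub_apply, sectorAnalysis_mul_sectorSub_apply]
  simp only [Matrix.cons_val_zero, trivialMultiplier]

/-- **Two legs: `W[1](S_c G) − W[1](G) = W[dress](G)_{(v−1, v)} + W[dress](G)_{(1, v−1)}`** (`m₀m₁ − 1 = (m₀ − 1)m₁ + (m₁ − 1)`), spins and charges of the legs kept. -/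
theorem sectorisedKernel_mulLeft_sub_two (β : ℝ) (c : HubbardFieldIdx L M → ℂ) (v : FreqMomentum L M → ℂ) (hc : ∀ X, c X = v X.1.1)
    (G : HubbardGrassmann L M) (Ω : Fin 2 → SectorLeg 1) (x : Fin 2 → SpaceTimeIdx L M) :
    sectorisedKernel L M β (trivialMultiplier L M) (ExteriorAlgebra.map (LinearMap.mulLeft ℂ c) G) 2 Ω x -
        sectorisedKernel L M β (trivialMultiplier L M) G 2 Ω x =
      sectorisedKernel L M β (![fun _ => 1, fun k => v k - 1, v] : Fin 3 → FreqMomentum L M → ℂ) G 2 (fun i => ((![(1 : Fin 3), 2] i, (Ω i).1.2), (Ω i).2)) x +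
        sectorisedKernel L M β (![fun _ => 1, fun k => v k - 1, v] : Fin 3 → FreqMomentum L M → ℂ) G 2 (fun i => ((![(0 : Fin 3), 1] i, (Ω i).1.2), (Ω i).2)) x := by
  rw [sectorisedKernel_map_mulLeft_momentum β _ c v hc, sectorisedKernel_def, sectorisedKernel_def, sectorisedKernel_def, sectorisedKernel_def,
    ← sum_sub_distrib, ← sum_add_distrib]
  refine sum_congr rfl fun k _ => ?_
  simp only [Fin.prod_univ_two, trivialMultiplier, one_mul, Matrix.cons_val_zero, Matrix.cons_val_one, Matrix.cons_val_two, Matrix.head_cons,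
    Matrix.tail_cons]
  ring

end TwoLegs

/-! ## §3 L¹ transport across a plateau with LEG-DEPENDENT constants (k3c2-p2's lemma refined) -/

section Transport

variable [NeZero L]

/-- Pinned sums of a product of transfer factors, leg-dependent column constants: `Σ_{x′} ∏_i ‖Θ_i((x₁::x′)_i, y_i)‖ ≤ ‖Θ_0(x₁, y_0)‖ · ∏_j D_j`. -/
theorem sum_prod_norm_vecCons_le' {m : ℕ} (Θ : Fin (m + 1) → SpaceTimeIdx L M → SpaceTimeIdx L M → ℂ) {D : Fin m → ℝ}
    (hcol : ∀ (j : Fin m) (y : SpaceTimeIdx L M), ∑ x, ‖Θ j.succ x y‖ ≤ D j) (x₁ : SpaceTimeIdx L M) (y : Fin (m + 1) → SpaceTimeIdx L M) :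
    ∑ x' : Fin m → SpaceTimeIdx L M, ∏ i, ‖Θ i (Matrix.vecCons x₁ x' i) (y i)‖ ≤ ‖Θ 0 x₁ (y 0)‖ * ∏ j, D j := by
  have h1 : ∀ x' : Fin m → SpaceTimeIdx L M, (∏ i, ‖Θ i (Matrix.vecCons x₁ x' i) (y i)‖) =
      ‖Θ 0 x₁ (y 0)‖ * ∏ j : Fin m, ‖Θ j.succ (x' j) (y j.succ)‖ := by
    intro x'
    rw [Fin.prod_univ_succ]
    simp only [Matrix.cons_val_zero, Matrix.cons_val_succ]
  simp_rw [h1]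
  have hfac : ∑ x' : Fin m → SpaceTimeIdx L M, ∏ j : Fin m, ‖Θ j.succ (x' j) (y j.succ)‖ =
      ∏ j : Fin m, ∑ z : SpaceTimeIdx L M, ‖Θ j.succ z (y j.succ)‖ := by
    rw [Finset.prod_univ_sum, Fintype.piFinset_univ]
  rw [← mul_sum, hfac]
  exact mul_le_mul_of_nonneg_left (prod_le_prod (fun j _ => sum_nonneg fun z _ => norm_nonneg _) fun j _ => hcol j (y j.succ)) (norm_nonneg _)

/-- **L¹ TRANSPORT ACROSS A PLATEAU, leg-dependent constants** (`0 < β`; any `G`; fine family `F′` in the plateau of the coarse family `F` under the fine tuple `Ω′`): with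
column sums `≤ Cc_j/ε` of the transfer kernel `Θ = E(F′)·S(1)` on the free legs `j ≥ 1`, pin row `≤ Cr/ε` on leg `0` AT THE PIN `x₁`, parents `Par` (every other coarse string misses
`Ω′` on some leg) of pinned size `≤ S`: `fixedTupleL1 β m W_{F′} Ω′ x₁ ≤ #Par · (Cr · ∏_j Cc_j) · S`.  (k3c2-p2's `fixedTupleL1_le_of_plateau_transfer` is the case `Cr = Cc_j = C_τ`.)
[cite: BenfattoGiulianiMastropietro2006, §2.7 (2.70)–(2.71a)] -/
theorem fixedTupleL1_le_of_plateau_transfer' [NeZero M] {N N' : ℕ} {β : ℝ} (hβ : 0 < β) (F' : Fin N' → FreqMomentum L M → ℂ) (F : Fin N → FreqMomentum L M → ℂ)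
    (G : HubbardGrassmann L M) {m : ℕ} (Ω' : Fin (m + 1) → SectorLeg N') (hpl : ∀ i k, F' (Ω' i).1.1 k ≠ 0 → ∑ w, F w k = 1)
    (Par : Finset (Fin (m + 1) → Fin N)) (hPar : ∀ σ, σ ∉ Par → ∃ i, ∀ k, F' (Ω' i).1.1 k * F (σ i) k = 0)
    {Cr S : ℝ} {Cc : Fin m → ℝ} (hCc0 : ∀ j, 0 ≤ Cc j) (hS0 : 0 ≤ S)
    (hcol : ∀ (j : Fin m) (y : SpaceTimeIdx L M), ∑ x : SpaceTimeIdx L M,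
      ‖(sectorAnalysisMatrix L M β F' * sectorSubMatrix L M β (trivialMultiplier L M)) (x, Ω' j.succ) (y, (((0 : Fin 1), (Ω' j.succ).1.2), (Ω' j.succ).2))‖ ≤
        Cc j / imagTimeWeight β M)
    (hS : ∀ σ ∈ Par, ∀ y₀ : SpaceTimeIdx L M,
      fixedTupleL1 L M β m (sectorisedKernel L M β F G (m + 1)) (fun i => ((σ i, (Ω' i).1.2), (Ω' i).2)) y₀ ≤ S)
    (x₁ : SpaceTimeIdx L M)
    (hrow : ∑ y : SpaceTimeIdx L M,
      ‖(sectorAnalysisMatrix L M β F' * sectorSubMatrix L M β (trivialMultiplier L M)) (x₁, Ω' 0) (y, (((0 : Fin 1), (Ω' 0).1.2), (Ω' 0).2))‖ ≤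
        Cr / imagTimeWeight β M) :
    fixedTupleL1 L M β m (sectorisedKernel L M β F' G (m + 1)) Ω' x₁ ≤ Par.card * (Cr * ∏ j, Cc j) * S := by
  have hMr : (0 : ℝ) < M := Nat.cast_pos.2 (Nat.pos_of_ne_zero (NeZero.ne M))
  have hε : 0 < imagTimeWeight β M := by unfold imagTimeWeight; positivity
  set ε : ℝ := imagTimeWeight β M with hεdef
  set Θ : Fin (m + 1) → SpaceTimeIdx L M → SpaceTimeIdx L M → ℂ := fun i xi yi =>
    (sectorAnalysisMatrix L M β F' * sectorSubMatrix L M β (trivialMultiplier L M)) (xi, Ω' i) (yi, (((0 : Fin 1), (Ω' i).1.2), (Ω' i).2)) with hΘ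
  set W : (Fin (m + 1) → Fin N) → (Fin (m + 1) → SpaceTimeIdx L M) → ℂ := fun σ y =>
    sectorisedKernel L M β F G (m + 1) (fun i => ((σ i, (Ω' i).1.2), (Ω' i).2)) y with hW
  have hPC : 0 ≤ ∏ j, Cc j := prod_nonneg fun j _ => hCc0 j
  -- pointwise: the fine kernel is the sum over parents of the transferred coarse kernels
  have hpt : ∀ x : Fin (m + 1) → SpaceTimeIdx L M, ‖sectorisedKernel L M β F' G (m + 1) Ω' x‖ ≤
      ∑ σ ∈ Par, ε ^ (m + 1) * ∑ y : Fin (m + 1) → SpaceTimeIdx L M, (∏ i, ‖Θ i (x i) (y i)‖) * ‖W σ y‖ := by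
    intro x
    rw [sectorisedKernel_eq_sum_coarse β F' F G Ω' hpl x]
    have hvan : ∀ σ ∈ (univ : Finset (Fin (m + 1) → Fin N)), σ ∉ Par →
        (∑ k : Fin (m + 1) → FreqMomentum L M,
          (∏ i, F' (Ω' i).1.1 (k i) * F (σ i) (k i) * hubbardPlaneWave L M β (Ω' i).2 (k i) (x i)) *
            kernel ℂ G (m + 1) (fun i => ((k i, (Ω' i).1.2), (Ω' i).2))) = 0 :=
      fun σ _ hσ => coarseTerm_eq_zero_of_leg β F' F G Ω' σ (hPar σ hσ) x
    rw [← Finset.sum_subset (subset_univ Par) hvan]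
    refine (norm_sum_le _ _).trans (sum_le_sum fun σ _ => ?_)
    rw [coarseTerm_eq_transfer_sum hβ.ne' F' F G Ω' σ x, norm_mul, norm_pow, Complex.norm_real, Real.norm_of_nonneg hε.le]
    refine mul_le_mul_of_nonneg_left ((norm_sum_le _ _).trans (sum_le_sum fun y _ => ?_)) (pow_nonneg hε.le _)
    rw [norm_mul, norm_prod]
  -- sum over the free positions with leg 0 pinned
  unfold fixedTupleL1
  have hstep1 : ε ^ m * ∑ x' : Fin m → SpaceTimeIdx L M, ‖sectorisedKernel L M β F' G (m + 1) Ω' (Matrix.vecCons x₁ x')‖ ≤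
      ε ^ m * ∑ x' : Fin m → SpaceTimeIdx L M, ∑ σ ∈ Par, ε ^ (m + 1) *
        ∑ y : Fin (m + 1) → SpaceTimeIdx L M, (∏ i, ‖Θ i (Matrix.vecCons x₁ x' i) (y i)‖) * ‖W σ y‖ :=
    mul_le_mul_of_nonneg_left (sum_le_sum fun x' _ => hpt _) (pow_nonneg hε.le m)
  refine hstep1.trans ?_
  rw [sum_comm]
  -- for each parent: the free-position sum of the transfer factors, then the pinned sizes
  have hσ : ∀ σ ∈ Par, ∑ x' : Fin m → SpaceTimeIdx L M, ε ^ (m + 1) *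
      ∑ y : Fin (m + 1) → SpaceTimeIdx L M, (∏ i, ‖Θ i (Matrix.vecCons x₁ x' i) (y i)‖) * ‖W σ y‖ ≤
        ε ^ (m + 1) * ((∏ j, Cc j / ε) * ((Cr / ε) * (S / ε ^ m))) := by
    intro σ hσP
    rw [← mul_sum, sum_comm]
    -- the `x′`-sum of the transfer factors
    have h1 : ∑ y : Fin (m + 1) → SpaceTimeIdx L M, ∑ x' : Fin m → SpaceTimeIdx L M, (∏ i, ‖Θ i (Matrix.vecCons x₁ x' i) (y i)‖) * ‖W σ y‖ ≤
        ∑ y : Fin (m + 1) → SpaceTimeIdx L M, ‖Θ 0 x₁ (y 0)‖ * (∏ j, Cc j / ε) * ‖W σ y‖ := by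
      refine sum_le_sum fun y _ => ?_
      rw [← sum_mul]
      exact mul_le_mul_of_nonneg_right (sum_prod_norm_vecCons_le' Θ (fun j yy => hcol j yy) x₁ y) (norm_nonneg _)
    -- split `y = y₀ :: y′` and use the pinned sizes of the parent
    have h2 : ∑ y : Fin (m + 1) → SpaceTimeIdx L M, ‖Θ 0 x₁ (y 0)‖ * (∏ j, Cc j / ε) * ‖W σ y‖ =
        (∏ j, Cc j / ε) * ∑ y₀ : SpaceTimeIdx L M, ‖Θ 0 x₁ y₀‖ * ∑ y' : Fin m → SpaceTimeIdx L M, ‖W σ (Matrix.vecCons y₀ y')‖ := by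
      rw [← (Fin.consEquiv fun _ : Fin (m + 1) => SpaceTimeIdx L M).sum_comp, Fintype.sum_prod_type, mul_sum]
      refine sum_congr rfl fun y₀ _ => ?_
      rw [mul_sum, mul_sum]
      refine sum_congr rfl fun y' _ => ?_
      have hc : ((Fin.consEquiv fun _ : Fin (m + 1) => SpaceTimeIdx L M) (y₀, y')) = Matrix.vecCons y₀ y' := rfl
      rw [hc, Matrix.cons_val_zero]; ring
    have h3 : ∀ y₀ : SpaceTimeIdx L M, ∑ y' : Fin m → SpaceTimeIdx L M, ‖W σ (Matrix.vecCons y₀ y')‖ ≤ S / ε ^ m := by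
      intro y₀
      rw [le_div_iff₀ (pow_pos hε m), mul_comm]
      exact hS σ hσP y₀
    have h4 : ∑ y₀ : SpaceTimeIdx L M, ‖Θ 0 x₁ y₀‖ * ∑ y' : Fin m → SpaceTimeIdx L M, ‖W σ (Matrix.vecCons y₀ y')‖ ≤ (Cr / ε) * (S / ε ^ m) := by
      calc ∑ y₀ : SpaceTimeIdx L M, ‖Θ 0 x₁ y₀‖ * ∑ y' : Fin m → SpaceTimeIdx L M, ‖W σ (Matrix.vecCons y₀ y')‖
          ≤ ∑ y₀ : SpaceTimeIdx L M, ‖Θ 0 x₁ y₀‖ * (S / ε ^ m) := sum_le_sum fun y₀ _ => mul_le_mul_of_nonneg_left (h3 y₀) (norm_nonneg _)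
        _ = (∑ y₀ : SpaceTimeIdx L M, ‖Θ 0 x₁ y₀‖) * (S / ε ^ m) := by rw [sum_mul]
        _ ≤ (Cr / ε) * (S / ε ^ m) := mul_le_mul_of_nonneg_right hrow (div_nonneg hS0 (pow_nonneg hε.le m))
    refine mul_le_mul_of_nonneg_left (h1.trans ?_) (pow_nonneg hε.le _)
    rw [h2]
    exact mul_le_mul_of_nonneg_left h4 (prod_nonneg fun j _ => div_nonneg (hCc0 j) hε.le)
  calc ε ^ m * ∑ σ ∈ Par, ∑ x' : Fin m → SpaceTimeIdx L M, ε ^ (m + 1) *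
        ∑ y : Fin (m + 1) → SpaceTimeIdx L M, (∏ i, ‖Θ i (Matrix.vecCons x₁ x' i) (y i)‖) * ‖W σ y‖
      ≤ ε ^ m * ∑ _σ ∈ Par, ε ^ (m + 1) * ((∏ j, Cc j / ε) * ((Cr / ε) * (S / ε ^ m))) :=
        mul_le_mul_of_nonneg_left (sum_le_sum hσ) (pow_nonneg hε.le m)
    _ = Par.card * (Cr * ∏ j, Cc j) * S := by
        have hε' : ε ≠ 0 := hε.ne'
        rw [sum_const, nsmul_eq_mul, prod_div_distrib, prod_const, card_univ, Fintype.card_fin, pow_succ]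
        field_simp

/-! ## §4 The pinned raw two-leg rows of a dressing difference -/

/-- The `m = 1` fixed-tuple size is the `ε`-weighted pinned row: `fixedTupleL1 β 1 W Ω x₀ = ε · Σ_{x₁} ‖W Ω ![x₀, x₁]‖`. -/
theorem fixedTupleL1_one_eq_sum {N : ℕ} (β : ℝ) (W : (Fin 2 → SectorLeg N) → (Fin 2 → SpaceTimeIdx L M) → ℂ) (Ω : Fin 2 → SectorLeg N) (x₀ : SpaceTimeIdx L M) :
    fixedTupleL1 L M β 1 W Ω x₀ = imagTimeWeight β M * ∑ x₁ : SpaceTimeIdx L M, ‖W Ω ![x₀, x₁]‖ := by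
  unfold fixedTupleL1
  rw [pow_one]
  congr 1
  refine Fintype.sum_equiv (Equiv.funUnique (Fin 1) (SpaceTimeIdx L M)) _ _ fun x' => ?_
  congr 2
  funext i
  refine Fin.cases rfl (fun j => ?_) i
  simp only [Matrix.cons_val_succ, Equiv.funUnique_apply]
  rw [Subsingleton.elim j default, Matrix.cons_val_fin_one]

/-- **THE PINNED RAW TWO-LEG ROWS OF A DRESSING DIFFERENCE** (`0 < β`; any `G`; momentum weight `c X = v X.1.1`): with the overlap kernels `Θ_w = E(w)·S(1)` of the members
of the family `(1, v−1, v)`, if the `ε`-normalised pin row of `Θ_{v−1}` at `x₀` is `≤ Rδ`, the `ε`-normalised column sums of `Θ_v`, `Θ_{v−1}` are `≤ Cv`, `≤ Cδ`, and every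
pinned raw two-leg row of `G` (same spins/charges) is `≤ S`, then
`fixedTupleL1 β 1 (W[1](S_c G) − W[1](G)) Ω x₀ ≤ (Rδ·Cv + Cδ)·S` — the trivial member's pin row being EXACTLY `ε⁻¹` (`rowSum_overlap_trivial_label_eq`).
[cite: BenfattoGiulianiMastropietro2006, §2.7 (2.70)–(2.71a)] -/
theorem fixedTupleL1_dress_sub_le [NeZero M] {β : ℝ} (hβ : 0 < β) (c : HubbardFieldIdx L M → ℂ) (v : FreqMomentum L M → ℂ) (hc : ∀ X, c X = v X.1.1)
    (G : HubbardGrassmann L M) (Ω : Fin 2 → SectorLeg 1) (x₀ : SpaceTimeIdx L M) {Rδ Cv Cδ S : ℝ} (hCv0 : 0 ≤ Cv) (hCδ0 : 0 ≤ Cδ) (hS0 : 0 ≤ S)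
    (hRδ : ∑ y : SpaceTimeIdx L M,
      ‖(sectorAnalysisMatrix L M β (![fun _ => 1, fun k => v k - 1, v] : Fin 3 → FreqMomentum L M → ℂ) * sectorSubMatrix L M β (trivialMultiplier L M)) (x₀, (((1 : Fin 3), (Ω 0).1.2), (Ω 0).2))
        (y, (((0 : Fin 1), (Ω 0).1.2), (Ω 0).2))‖ ≤ Rδ / imagTimeWeight β M)
    (hCv : ∀ y : SpaceTimeIdx L M, ∑ x : SpaceTimeIdx L M,
      ‖(sectorAnalysisMatrix L M β (![fun _ => 1, fun k => v k - 1, v] : Fin 3 → FreqMomentum L M → ℂ) * sectorSubMatrix L M β (trivialMultiplier L M)) (x, (((2 : Fin 3), (Ω 1).1.2), (Ω 1).2))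
        (y, (((0 : Fin 1), (Ω 1).1.2), (Ω 1).2))‖ ≤ Cv / imagTimeWeight β M)
    (hCδ : ∀ y : SpaceTimeIdx L M, ∑ x : SpaceTimeIdx L M,
      ‖(sectorAnalysisMatrix L M β (![fun _ => 1, fun k => v k - 1, v] : Fin 3 → FreqMomentum L M → ℂ) * sectorSubMatrix L M β (trivialMultiplier L M)) (x, (((1 : Fin 3), (Ω 1).1.2), (Ω 1).2))
        (y, (((0 : Fin 1), (Ω 1).1.2), (Ω 1).2))‖ ≤ Cδ / imagTimeWeight β M)
    (hS : ∀ y₀ : SpaceTimeIdx L M,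
      fixedTupleL1 L M β 1 (sectorisedKernel L M β (trivialMultiplier L M) G 2) (fun i => (((0 : Fin 1), (Ω i).1.2), (Ω i).2)) y₀ ≤ S) :
    fixedTupleL1 L M β 1 (fun Ω' x => sectorisedKernel L M β (trivialMultiplier L M) (ExteriorAlgebra.map (LinearMap.mulLeft ℂ c) G) 2 Ω' x -
        sectorisedKernel L M β (trivialMultiplier L M) G 2 Ω' x) Ω x₀ ≤ (Rδ * Cv + Cδ) * S := by
  have hMr : (0 : ℝ) < M := Nat.cast_pos.2 (Nat.pos_of_ne_zero (NeZero.ne M))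
  have hε : 0 < imagTimeWeight β M := by unfold imagTimeWeight; positivity
  -- the two dressed strings
  set Ωa : Fin 2 → SectorLeg 3 := fun i => ((![(1 : Fin 3), 2] i, (Ω i).1.2), (Ω i).2) with hΩa
  set Ωb : Fin 2 → SectorLeg 3 := fun i => ((![(0 : Fin 3), 1] i, (Ω i).1.2), (Ω i).2) with hΩb
  -- plateau of the trivial coarse family; the unique parent
  have hpl : ∀ (Ω' : Fin 2 → SectorLeg 3) (i : Fin 2) (k : FreqMomentum L M), (![fun _ => 1, fun k => v k - 1, v] : Fin 3 → FreqMomentum L M → ℂ) (Ω' i).1.1 k ≠ 0 → ∑ w, trivialMultiplier L M w k = 1 :=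
    fun _ _ k _ => by simp [trivialMultiplier]
  have hPar : ∀ (Ω' : Fin 2 → SectorLeg 3) (σ : Fin 2 → Fin 1), σ ∉ (univ : Finset (Fin 2 → Fin 1)) →
      ∃ i, ∀ k, (![fun _ => 1, fun k => v k - 1, v] : Fin 3 → FreqMomentum L M → ℂ) (Ω' i).1.1 k * trivialMultiplier L M (σ i) k = 0 := fun _ σ h => absurd (mem_univ σ) h
  have hcard : ((univ : Finset (Fin 2 → Fin 1)).card : ℝ) = 1 := by simp
  -- the parents' pinned sizes: the string of the unique parent IS the trivial string
  have hparent : ∀ (Ω' : Fin 2 → SectorLeg 3), (∀ i, (Ω' i).1.2 = (Ω i).1.2 ∧ (Ω' i).2 = (Ω i).2) →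
      ∀ σ ∈ (univ : Finset (Fin 2 → Fin 1)), ∀ y₀ : SpaceTimeIdx L M,
        fixedTupleL1 L M β 1 (sectorisedKernel L M β (trivialMultiplier L M) G 2) (fun i => ((σ i, (Ω' i).1.2), (Ω' i).2)) y₀ ≤ S := by
    intro Ω' hΩ' σ _ y₀
    have hσ : (fun i => ((σ i, (Ω' i).1.2), (Ω' i).2)) = (fun i => (((0 : Fin 1), (Ω i).1.2), (Ω i).2) : Fin 2 → SectorLeg 1) := by
      funext i; rw [Subsingleton.elim (σ i) 0, (hΩ' i).1, (hΩ' i).2]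
    rw [hσ]; exact hS y₀
  -- term (a): `(v − 1)` on leg 0, `v` on leg 1
  have ha := fixedTupleL1_le_of_plateau_transfer' hβ (![fun _ => 1, fun k => v k - 1, v] : Fin 3 → FreqMomentum L M → ℂ) (trivialMultiplier L M) G Ωa (hpl Ωa) univ (hPar Ωa)
    (Cr := Rδ) (Cc := fun _ : Fin 1 => Cv) (fun _ => hCv0) hS0
    (fun j y => by
      have hj : j = 0 := Subsingleton.elim _ _
      subst hj
      simpa [hΩa] using hCv y)
    (hparent Ωa fun i => ⟨rfl, rfl⟩) x₀ (by simpa [hΩa] using hRδ)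
  -- term (b): `1` on leg 0 (pin row EXACTLY `ε⁻¹`), `(v − 1)` on leg 1
  have hb := fixedTupleL1_le_of_plateau_transfer' hβ (![fun _ => 1, fun k => v k - 1, v] : Fin 3 → FreqMomentum L M → ℂ) (trivialMultiplier L M) G Ωb (hpl Ωb) univ (hPar Ωb)
    (Cr := 1) (Cc := fun _ : Fin 1 => Cδ) (fun _ => hCδ0) hS0
    (fun j y => by
      have hj : j = 0 := Subsingleton.elim _ _
      subst hj
      simpa [hΩb] using hCδ y)
    (hparent Ωb fun i => ⟨rfl, rfl⟩) x₀ (by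
      have h1 : ∑ y : SpaceTimeIdx L M,
          ‖(sectorAnalysisMatrix L M β (![fun _ => 1, fun k => v k - 1, v] : Fin 3 → FreqMomentum L M → ℂ) * sectorSubMatrix L M β (trivialMultiplier L M)) (x₀, Ωb 0) (y, (((0 : Fin 1), (Ωb 0).1.2), (Ωb 0).2))‖ =
            (imagTimeWeight β M)⁻¹ := by
        have hΩb0 : Ωb 0 = (((0 : Fin 3), (Ω 0).1.2), (Ω 0).2) := by simp [hΩb]
        rw [hΩb0]
        simp only [dress_overlap_zero_eq]
        exact rowSum_overlap_trivial_label_eq hβ (Ω 0).1.2 (Ω 0).2 x₀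
      rw [h1, one_div])
  -- the constants
  have hca : ((univ : Finset (Fin 2 → Fin 1)).card : ℝ) * (Rδ * ∏ _j : Fin 1, Cv) * S = Rδ * Cv * S := by
    rw [hcard, prod_const, card_univ, Fintype.card_fin, pow_one, one_mul]
  have hcb : ((univ : Finset (Fin 2 → Fin 1)).card : ℝ) * (1 * ∏ _j : Fin 1, Cδ) * S = Cδ * S := by
    rw [hcard, prod_const, card_univ, Fintype.card_fin, pow_one, one_mul, one_mul]
  rw [hca] at ha
  rw [hcb] at hb
  -- the difference kernel is the sum of the two dressed kernels, termwise
  unfold fixedTupleL1 at ha hb ⊢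
  have hpt : ∀ x' : Fin 1 → SpaceTimeIdx L M,
      ‖sectorisedKernel L M β (trivialMultiplier L M) (ExteriorAlgebra.map (LinearMap.mulLeft ℂ c) G) 2 Ω (Matrix.vecCons x₀ x') -
          sectorisedKernel L M β (trivialMultiplier L M) G 2 Ω (Matrix.vecCons x₀ x')‖ ≤
        ‖sectorisedKernel L M β (![fun _ => 1, fun k => v k - 1, v] : Fin 3 → FreqMomentum L M → ℂ) G 2 Ωa (Matrix.vecCons x₀ x')‖ +
          ‖sectorisedKernel L M β (![fun _ => 1, fun k => v k - 1, v] : Fin 3 → FreqMomentum L M → ℂ) G 2 Ωb (Matrix.vecCons x₀ x')‖ := by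
    intro x'
    rw [sectorisedKernel_mulLeft_sub_two β c v hc G Ω]
    exact norm_add_le _ _
  calc imagTimeWeight β M ^ 1 * ∑ x' : Fin 1 → SpaceTimeIdx L M,
        ‖sectorisedKernel L M β (trivialMultiplier L M) (ExteriorAlgebra.map (LinearMap.mulLeft ℂ c) G) 2 Ω (Matrix.vecCons x₀ x') -
          sectorisedKernel L M β (trivialMultiplier L M) G 2 Ω (Matrix.vecCons x₀ x')‖
      ≤ imagTimeWeight β M ^ 1 * ∑ x' : Fin 1 → SpaceTimeIdx L M,
          (‖sectorisedKernel L M β (![fun _ => 1, fun k => v k - 1, v] : Fin 3 → FreqMomentum L M → ℂ) G 2 Ωa (Matrix.vecCons x₀ x')‖ +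
            ‖sectorisedKernel L M β (![fun _ => 1, fun k => v k - 1, v] : Fin 3 → FreqMomentum L M → ℂ) G 2 Ωb (Matrix.vecCons x₀ x')‖) :=
        mul_le_mul_of_nonneg_left (sum_le_sum fun x' _ => hpt x') (pow_nonneg hε.le 1)
    _ = imagTimeWeight β M ^ 1 * ∑ x' : Fin 1 → SpaceTimeIdx L M, ‖sectorisedKernel L M β (![fun _ => 1, fun k => v k - 1, v] : Fin 3 → FreqMomentum L M → ℂ) G 2 Ωa (Matrix.vecCons x₀ x')‖ +
          imagTimeWeight β M ^ 1 * ∑ x' : Fin 1 → SpaceTimeIdx L M, ‖sectorisedKernel L M β (![fun _ => 1, fun k => v k - 1, v] : Fin 3 → FreqMomentum L M → ℂ) G 2 Ωb (Matrix.vecCons x₀ x')‖ := by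
        rw [sum_add_distrib, mul_add]
    _ ≤ Rδ * Cv * S + Cδ * S := add_le_add ha hb
    _ = (Rδ * Cv + Cδ) * S := by ring

end Transport

/-! ## §5 Interface to the lifted rows of `hdualSp`: the lift `ȳ ↦ proj_{L₂}(cRep ȳ)` is injective, so lifted pinned rows are at most full pinned rows -/

section Lift

/-- **The centred lift between nested tori is injective**: for `L₁ ≤ L₂`, `ȳ ↦ Torus.proj L₂ (Torus.cRep ȳ)` is injective on `TorusSite d L₁`
(two centred representatives differ by less than `L₁ ≤ L₂` in every coordinate). [folklore] -/
theorem proj_cRep_injective_of_le {d L₁ L₂ : ℕ} [NeZero L₁] (hL : L₁ ≤ L₂) :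
    Function.Injective fun ybar : TorusSite d L₁ => Torus.proj L₂ (Torus.cRep ybar) := by
  intro u v h
  apply Torus.cRep_injective
  funext i
  have hi : ((Torus.cRep u i : ℤ) : ZMod L₂) = ((Torus.cRep v i : ℤ) : ZMod L₂) := by
    have := congrFun h i
    simpa only [Torus.proj_apply] using this
  rcases Torus.sub_repr_dichotomy (L := L₂) hi with h' | h'
  · exact h'
  · exfalso
    have hu := Torus.two_mul_cRepZ_bounds (L := L₁) (u i)
    have hv := Torus.two_mul_cRepZ_bounds (L := L₁) (v i)
    have hL' : (L₁ : ℤ) ≤ L₂ := by exact_mod_cast hL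
    have hlt : |Torus.cRep u i - Torus.cRep v i| < L₁ := by
      rw [abs_lt]; unfold Torus.cRep; constructor <;> omega
    linarith

/-- **Lifted pinned rows are at most full pinned rows**: for an injective `h : TorusSite 2 L₁ → TorusSite 2 L₂` and `f ≥ 0` on the fine space-time labels,
`Σ_{t₁} Σ_ȳ f (t₁, h ȳ) ≤ Σ_{x₁} f x₁`. [folklore] -/
theorem sum_sum_lift_le_sum {L₁ L₂ M : ℕ} [NeZero L₁] [NeZero L₂] (h : TorusSite 2 L₁ → TorusSite 2 L₂) (hh : Function.Injective h)
    (f : SpaceTimeIdx L₂ M → ℝ) (hf : ∀ x, 0 ≤ f x) :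
    ∑ t₁ : ImagTimeIdx M, ∑ ybar : TorusSite 2 L₁, f (t₁, h ybar) ≤ ∑ x₁ : SpaceTimeIdx L₂ M, f x₁ := by
  classical
  have hginj : Function.Injective fun p : ImagTimeIdx M × TorusSite 2 L₁ => ((p.1, h p.2) : SpaceTimeIdx L₂ M) := by
    rintro ⟨a, b⟩ ⟨a', b'⟩ hab
    simp only [Prod.mk.injEq] at hab
    exact Prod.ext hab.1 (hh hab.2)
  have h1 : ∑ t₁ : ImagTimeIdx M, ∑ ybar : TorusSite 2 L₁, f (t₁, h ybar) =
      ∑ p : ImagTimeIdx M × TorusSite 2 L₁, f ((p.1, h p.2) : SpaceTimeIdx L₂ M) := by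
    rw [Fintype.sum_prod_type]
  have h2 : ∑ p : ImagTimeIdx M × TorusSite 2 L₁, f ((p.1, h p.2) : SpaceTimeIdx L₂ M) =
      ∑ x ∈ (univ : Finset (ImagTimeIdx M × TorusSite 2 L₁)).image (fun p => ((p.1, h p.2) : SpaceTimeIdx L₂ M)), f x := by
    rw [sum_image fun p _ q _ hpq => hginj hpq]
  rw [h1, h2]
  exact sum_le_sum_of_subset_of_nonneg (subset_univ _) fun x _ _ => hf x

/-- **The two lifted offset rows of `hdualSp` at a fine pin are at most twice the full pinned row** (`L₁ ≤ L₂`; both signs `of.2 ± proj(cRep ȳ)`). [folklore] -/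
theorem sum_lifted_offsets_le_two_mul {L₁ L₂ M : ℕ} [NeZero L₁] [NeZero L₂] (hL : L₁ ≤ L₂) (W : (Fin 2 → SpaceTimeIdx L₂ M) → ℂ) (of : SpaceTimeIdx L₂ M) :
    ∑ t₁ : ImagTimeIdx M, ∑ ybar : TorusSite 2 L₁,
        (‖W ![of, (t₁, of.2 + Torus.proj L₂ (Torus.cRep ybar))]‖ + ‖W ![of, (t₁, of.2 + -Torus.proj L₂ (Torus.cRep ybar))]‖) ≤
      2 * ∑ x₁ : SpaceTimeIdx L₂ M, ‖W ![of, x₁]‖ := by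
  have hι := proj_cRep_injective_of_le (d := 2) hL
  have h₁ := sum_sum_lift_le_sum (M := M) (fun ybar : TorusSite 2 L₁ => of.2 + Torus.proj L₂ (Torus.cRep ybar))
    (fun u v huv => hι (add_left_cancel huv)) (fun x₁ => ‖W ![of, x₁]‖) fun _ => norm_nonneg _
  have h₂ := sum_sum_lift_le_sum (M := M) (fun ybar : TorusSite 2 L₁ => of.2 + -Torus.proj L₂ (Torus.cRep ybar))
    (fun u v huv => hι (neg_injective (add_left_cancel huv))) (fun x₁ => ‖W ![of, x₁]‖) fun _ => norm_nonneg _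
  have hsplit : ∑ t₁ : ImagTimeIdx M, ∑ ybar : TorusSite 2 L₁,
      (‖W ![of, (t₁, of.2 + Torus.proj L₂ (Torus.cRep ybar))]‖ + ‖W ![of, (t₁, of.2 + -Torus.proj L₂ (Torus.cRep ybar))]‖) =
      (∑ t₁ : ImagTimeIdx M, ∑ ybar : TorusSite 2 L₁, ‖W ![of, (t₁, of.2 + Torus.proj L₂ (Torus.cRep ybar))]‖) +
        ∑ t₁ : ImagTimeIdx M, ∑ ybar : TorusSite 2 L₁, ‖W ![of, (t₁, of.2 + -Torus.proj L₂ (Torus.cRep ybar))]‖ := by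
    rw [← sum_add_distrib]
    exact sum_congr rfl fun t₁ _ => sum_add_distrib
  rw [hsplit]
  linarith

end Lift

end Summit.HubbardSuperconductivity.HubbardSuperconductivity.Theorems.TwoVolumeDefect

end
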